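import Mathlib.MeasureTheory.Measure.MeasuredSets
import Mathlib.MeasureTheory.SetAlgebra
import Mathlib.MeasureTheory.MeasurableSpace.CountablyGenerated
import Mathlib.Analysis.SpecificLimits.Basic
import Mathlib.MeasureTheory.Measure.Decomposition.RadonNikodym
import Mathlib.MeasureTheory.Function.AEEqOfLIntegral
import Literature.Probability.Exchangeability.DeFinetti
import HarnessLib

/-!
# de Finetti: uniform (`L∞`) bounds pass to the directing measure

The "density form under uniform (`L∞`) bounds" of the de Finetti / Hewitt–Savage theorem, as it
is used for bounded correlation functions of particle systems: if the `k`-point laws of an exchangeable `P` are dominated by the powers of `C·μ` for a finite reference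
measure `μ` on `E` — it suffices to know `P {x | x 0, …, x (k-1) ∈ B} ≤ (C μ B)^k` for all `k`
and all measurable `B` — then the directing measure satisfies `ν_x ≤ C·μ` for `P`-a.e. `x`
(`IsExchangeable.ae_directingKernel_le_smul`), hence `ν_x ≪ μ` with density `≤ C` a.e.
(`IsExchangeable.ae_rnDeriv_directingKernel_le`).

Proof: `E_P[ν(B)^k] = P {x 0, …, x (k-1) ∈ B} ≤ (C μ B)^k` for every `k` (box formula) forces
`ν(B) ≤ C μ B` a.s. (Markov in `k → ∞`); simultaneously on a countable generating set ALGEBRA,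
and an inequality between finite measures on a generating ring of sets extends to the σ-algebra
(`measure_le_of_forall_le_of_isSetRing`, by approximation in measure).

## References

* O. Kallenberg, *Foundations of Modern Probability*, 2nd ed. (2002), Thm 11.10 (the theorem
  whose directing measure is bounded here; the corollary itself is proved in this file).
  [Kallenberg2002]
-/

namespace Literature.Probability.Exchangeability

open _root_.MeasureTheory _root_.ProbabilityTheory Equiv Function Set Finset Filter
open scoped Topology ENNReal NNReal symmDiff

/-- **An inequality between finite measures on a generating ring of sets (containing `univ`)
extends to all measurable sets** (approximation of measurable sets by ring sets in
`(ν + ρ)`-measure). [folklore] -/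
theorem measure_le_of_forall_le_of_isSetRing {α : Type*} [mα : MeasurableSpace α]
    {ν ρ : Measure α} [IsFiniteMeasure ν] [IsFiniteMeasure ρ] {C : Set (Set α)}
    (hC : IsSetRing C) (huniv : Set.univ ∈ C) (hgen : mα = MeasurableSpace.generateFrom C)
    (h : ∀ s ∈ C, ν s ≤ ρ s) : ν ≤ ρ := by
  rw [Measure.le_iff]
  intro s hs
  refine ENNReal.le_of_forall_pos_le_add fun ε hε _ => ?_
  have hD : ∃ D : Set (Set α), D.Countable ∧ D ⊆ C ∧ (ν + ρ) (⋃₀ D)ᶜ = 0 :=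
    ⟨{Set.univ}, Set.countable_singleton _, by simpa using huniv, by simp⟩
  obtain ⟨t, htC, ht⟩ := exists_measure_symmDiff_lt_of_generateFrom_isSetRing (μ := ν + ρ)
    hC hD hgen hs (ENNReal.coe_pos.mpr hε)
  have h1 : ν s ≤ ν t + ν (s \ t) :=
    (measure_mono (s := s) (by intro x hx; by_cases hxt : x ∈ t <;> simp [hx, hxt])).trans
      (measure_union_le t (s \ t))
  have h2 : ρ t ≤ ρ s + ρ (t \ s) :=
    (measure_mono (s := t) (by intro x hx; by_cases hxs : x ∈ s <;> simp [hx, hxs])).trans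
      (measure_union_le s (t \ s))
  have h3 : ρ (t \ s) + ν (s \ t) ≤ (ν + ρ) (t ∆ s) := by
    rw [Measure.add_apply]
    calc ρ (t \ s) + ν (s \ t) = ν (s \ t) + ρ (t \ s) := add_comm _ _
      _ ≤ ν (t ∆ s) + ρ (t ∆ s) :=
        add_le_add (measure_mono fun x hx => Set.mem_symmDiff.mpr (Or.inr hx))
          (measure_mono fun x hx => Set.mem_symmDiff.mpr (Or.inl hx))
  calc ν s ≤ ν t + ν (s \ t) := h1
    _ ≤ ρ t + ν (s \ t) := add_le_add (h t htC) le_rfl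
    _ ≤ ρ s + ρ (t \ s) + ν (s \ t) := add_le_add h2 le_rfl
    _ = ρ s + (ρ (t \ s) + ν (s \ t)) := add_assoc _ _ _
    _ ≤ ρ s + (ν + ρ) (t ∆ s) := add_le_add le_rfl h3
    _ ≤ ρ s + ε := add_le_add le_rfl ht.le

variable {E : Type*} [MeasurableSpace E] [StandardBorelSpace E]

namespace IsExchangeable

variable {P : Measure (ℕ → E)} [IsProbabilityMeasure P]

/-- **Moments of the directing measure**: `∫ ν_x(B)^k P(dx) = P {x 0, …, x (k-1) ∈ B}`.
[cite: Kallenberg2002, Thm 11.10] -/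
theorem lintegral_directingKernel_pow (h : IsExchangeable P) {B : Set E} (hB : MeasurableSet B)
    (k : ℕ) : ∫⁻ x, directingKernel P x B ^ k ∂P = P {x | ∀ i : Fin k, x i ∈ B} := by
  rw [h.measure_pi_eq_lintegral_prod (fun _ : Fin k => B) fun _ => hB]
  simp

/-- **Uniform bounds on the one-set moments force an a.s. bound on the directing measure**:
if `P {x 0, …, x (k-1) ∈ B} ≤ (C μ B)^k` for all `k`, then `ν_x (B) ≤ C μ B` for `P`-a.e. `x`.
[folklore] -/
theorem ae_directingKernel_apply_le (h : IsExchangeable P) {B : Set E} (hB : MeasurableSet B)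
    {c : ℝ≥0∞} (hc : c ≠ ∞) (hdom : ∀ k : ℕ, P {x | ∀ i : Fin k, x i ∈ B} ≤ c ^ k) :
    ∀ᵐ x ∂P, directingKernel P x B ≤ c := by
  set Z : (ℕ → E) → ℝ≥0∞ := fun x => directingKernel P x B with hZ
  have hZm : Measurable Z := (directingKernel P).measurable_coe hB
  have hmom : ∀ k : ℕ, ∫⁻ x, Z x ^ k ∂P ≤ c ^ k := fun k =>
    (h.lintegral_directingKernel_pow hB k).trans_le (hdom k)
  -- P{c + δ ≤ Z} = 0 for every δ > 0
  have hzero : ∀ δ : ℝ≥0∞, 0 < δ → δ ≠ ∞ → P {x | c + δ ≤ Z x} = 0 := by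
    intro δ hδ hδ'
    have hcd0 : c + δ ≠ 0 := (hδ.trans_le le_add_self).ne'
    have hcdt : c + δ ≠ ∞ := ENNReal.add_ne_top.mpr ⟨hc, hδ'⟩
    set r : ℝ≥0∞ := c / (c + δ) with hr
    have hr1 : r < 1 := by
      rw [hr, ENNReal.div_lt_iff (Or.inl hcd0) (Or.inl hcdt), one_mul]
      exact ENNReal.lt_add_right hc hδ.ne'
    have hbound : ∀ k : ℕ, P {x | c + δ ≤ Z x} ≤ r ^ k := by
      intro k
      have hsub : {x | c + δ ≤ Z x} ⊆ {x | (c + δ) ^ k ≤ Z x ^ k} :=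
        fun x (hx : c + δ ≤ Z x) => show (c + δ) ^ k ≤ Z x ^ k from pow_le_pow_left' hx k
      have hmk := mul_meas_ge_le_lintegral₀ (hZm.pow_const k).aemeasurable ((c + δ) ^ k) (μ := P)
      have hle : (c + δ) ^ k * P {x | c + δ ≤ Z x} ≤ c ^ k :=
        ((mul_le_mul' le_rfl (measure_mono hsub)).trans hmk).trans (hmom k)
      have hpk0 : (c + δ) ^ k ≠ 0 := pow_ne_zero _ hcd0
      have hpkt : (c + δ) ^ k ≠ ∞ := ENNReal.pow_ne_top hcdt
      calc P {x | c + δ ≤ Z x} ≤ c ^ k / (c + δ) ^ k := by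
            rw [ENNReal.le_div_iff_mul_le (Or.inl hpk0) (Or.inl hpkt), mul_comm]
            exact hle
        _ = r ^ k := by
            rw [hr, div_eq_mul_inv, div_eq_mul_inv, mul_pow, ENNReal.inv_pow]
    have htend : Tendsto (fun k : ℕ => r ^ k) atTop (𝓝 0) :=
      ENNReal.tendsto_pow_atTop_nhds_zero_of_lt_one hr1
    exact nonpos_iff_eq_zero.mp (ge_of_tendsto' htend hbound)
  -- hence a.e. `Z < c + (n+1)⁻¹` for all `n`, i.e. `Z ≤ c`
  have hae : ∀ᵐ x ∂P, ∀ n : ℕ, Z x < c + ((n : ℝ≥0∞) + 1)⁻¹ := by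
    rw [ae_all_iff]
    intro n
    have hn0 : (0 : ℝ≥0∞) < ((n : ℝ≥0∞) + 1)⁻¹ := by simp
    have hnt : ((n : ℝ≥0∞) + 1)⁻¹ ≠ ∞ := by simp
    rw [ae_iff]
    simpa only [not_lt] using hzero _ hn0 hnt
  filter_upwards [hae] with x hx
  refine ENNReal.le_of_forall_pos_le_add fun ε hε _ => ?_
  obtain ⟨n, hn⟩ := ENNReal.exists_inv_nat_lt (ENNReal.coe_ne_zero.mpr hε.ne')
  calc Z x ≤ c + ((n : ℝ≥0∞) + 1)⁻¹ := (hx n).le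
    _ ≤ c + (n : ℝ≥0∞)⁻¹ := by gcongr; exact le_self_add
    _ ≤ c + ε := by gcongr

/-- **de Finetti, density form under uniform bounds**: if the one-set moments of an
exchangeable `P` are dominated by a finite reference measure, `P {x 0, …, x (k-1) ∈ B} ≤ (C μ B)^k`
for all `k` and measurable `B` (e.g. `P` has `k`-point densities `≤ C^k ρ^{⊗k}` w.r.t. `μ^{⊗k}`,
`μ = ρ · vol`), then the directing measure is dominated too: `ν_x ≤ C • μ` for `P`-a.e. `x` —
the random law is a.s. absolutely continuous with density `≤ C ρ` (the form in which
Hewitt–Savage is applied to uniformly bounded correlation functions). [folklore] -/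
theorem ae_directingKernel_le_smul (h : IsExchangeable P) (μ : Measure E) [IsFiniteMeasure μ]
    (C : ℝ≥0)
    (hdom : ∀ (k : ℕ) (B : Set E), MeasurableSet B →
      P {x | ∀ i : Fin k, x i ∈ B} ≤ ((C : ℝ≥0∞) * μ B) ^ k) :
    ∀ᵐ x ∂P, directingKernel P x ≤ (C : ℝ≥0∞) • μ := by
  haveI : IsFiniteMeasure ((C : ℝ≥0∞) • μ) :=
    ⟨by rw [Measure.smul_apply, smul_eq_mul]
        exact ENNReal.mul_lt_top ENNReal.coe_lt_top (measure_lt_top μ _)⟩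
  -- a countable generating set algebra
  set 𝒜 := generateSetAlgebra (MeasurableSpace.countableGeneratingSet E) with h𝒜
  have h𝒜c : 𝒜.Countable :=
    countable_generateSetAlgebra (MeasurableSpace.countable_countableGeneratingSet (α := E))
  have h𝒜alg : IsSetAlgebra 𝒜 := isSetAlgebra_generateSetAlgebra
  have h𝒜gen : ‹MeasurableSpace E› = MeasurableSpace.generateFrom 𝒜 := by
    rw [h𝒜, generateFrom_generateSetAlgebra_eq, MeasurableSpace.generateFrom_countableGeneratingSet]
  have h𝒜meas : ∀ A ∈ 𝒜, MeasurableSet A := fun A hA => by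
    have hA' := MeasurableSpace.measurableSet_generateFrom hA
    rwa [← h𝒜gen] at hA'
  have hall : ∀ᵐ x ∂P, ∀ A ∈ 𝒜, directingKernel P x A ≤ (C : ℝ≥0∞) * μ A := by
    rw [ae_ball_iff h𝒜c]
    intro A hA
    exact h.ae_directingKernel_apply_le (h𝒜meas A hA)
      (ENNReal.mul_ne_top ENNReal.coe_ne_top (measure_ne_top μ A)) fun k => hdom k A (h𝒜meas A hA)
  filter_upwards [hall] with x hx
  refine measure_le_of_forall_le_of_isSetRing h𝒜alg.isSetRing h𝒜alg.univ_mem h𝒜gen fun A hA => ?_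
  rw [Measure.smul_apply, smul_eq_mul]
  exact hx A hA

/-- Consequence: under the hypotheses of `ae_directingKernel_le_smul` the directing measure is
a.s. absolutely continuous w.r.t. the reference measure. [folklore] -/
theorem ae_directingKernel_absolutelyContinuous (h : IsExchangeable P) (μ : Measure E)
    [IsFiniteMeasure μ] (C : ℝ≥0)
    (hdom : ∀ (k : ℕ) (B : Set E), MeasurableSet B →
      P {x | ∀ i : Fin k, x i ∈ B} ≤ ((C : ℝ≥0∞) * μ B) ^ k) :
    ∀ᵐ x ∂P, directingKernel P x ≪ μ := by
  filter_upwards [h.ae_directingKernel_le_smul μ C hdom] with x hx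
  exact Measure.absolutelyContinuous_of_le_smul hx


/-- **Density form**: under the hypotheses of `ae_directingKernel_le_smul`, for `P`-a.e. `x` the
directing measure has a density w.r.t. `μ` bounded by `C` (`μ`-a.e.), and is recovered from it:
`ν_x = μ.withDensity (dν_x/dμ)` with `dν_x/dμ ≤ C`.  In the route's language: the random law is a
random probability density `Λ ≤ C` (w.r.t. the reference measure). [folklore] -/
theorem ae_rnDeriv_directingKernel_le (h : IsExchangeable P) (μ : Measure E) [IsFiniteMeasure μ]
    (C : ℝ≥0)
    (hdom : ∀ (k : ℕ) (B : Set E), MeasurableSet B →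
      P {x | ∀ i : Fin k, x i ∈ B} ≤ ((C : ℝ≥0∞) * μ B) ^ k) :
    ∀ᵐ x ∂P, μ.withDensity ((directingKernel P x).rnDeriv μ) = directingKernel P x ∧
      (directingKernel P x).rnDeriv μ ≤ᵐ[μ] fun _ => (C : ℝ≥0∞) := by
  filter_upwards [h.ae_directingKernel_le_smul μ C hdom] with x hx
  have hac : directingKernel P x ≪ μ := Measure.absolutelyContinuous_of_le_smul hx
  refine ⟨Measure.withDensity_rnDeriv_eq _ _ hac, ?_⟩
  refine ae_le_of_forall_setLIntegral_le_of_sigmaFinite (Measure.measurable_rnDeriv _ _)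
    fun s hs _ => ?_
  rw [Measure.setLIntegral_rnDeriv hac, setLIntegral_const]
  calc directingKernel P x s ≤ ((C : ℝ≥0∞) • μ) s := hx s
    _ = (C : ℝ≥0∞) * μ s := by rw [Measure.smul_apply, smul_eq_mul]

end IsExchangeable

end Literature.Probability.Exchangeability
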